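import Literature.Barriers.RiemannHypothesis.TuranPartialSumsRun0
import Literature.Barriers.RiemannHypothesis.TuranPartialSumsRun1
import Literature.Barriers.RiemannHypothesis.TuranPartialSumsRun2
import Literature.Barriers.RiemannHypothesis.TuranPartialSumsRun3
import Literature.Barriers.RiemannHypothesis.TuranPartialSumsRun4
import Literature.Barriers.RiemannHypothesis.TuranPartialSumsRun5
import Literature.Barriers.RiemannHypothesis.TuranPartialSumsAssembly
import Literature.Barriers.RiemannHypothesis.TuranPartialSumsNine
import HarnessLib

/-!
# Sections of `ζ` beyond `σ = 1`: what the kernel certificates give (`N ≤ 1000`)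

Barrier catalogue `Literature/Barriers/RiemannHypothesis/`, companion of `TuranPartialSums.lean` and
`TuranPartialSumsAssembly.lean`. Pure proof file (nothing is defined or asserted): the assembly of
the certified runs `TuranPartialSumsRun0–5.lean` (zeros of `ζ_N` with `Re s > 1` for `N = 19`,
`22 ≤ N ≤ 27` and `29 ≤ N ≤ 1000`, each a kernel computation of the `σ = 1` criterion
`exists_zero_of_criterion` through `exists_zero_of_checkSegs`).

* `exists_zero_of_certificate` — for `29 ≤ N ≤ 1000`, `ζ_N` has a zero with `Re s > 1`.
* **Discharges.** The two existence inputs of Platt–Trudgian 2016, Theorem 1.1 that concern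
  `N ≤ 50` become theorems: `vandeLuneTeRiele1982_exists_zero_holds` (the zeros computed by
  van de Lune–te Riele for `N = 19, 22–27, 29–35, 37–41, 47`, as reported in Platt–Trudgian 2016,
  §1) and `Spira1968_exists_zero_holds` (Spira 1968, §4 Table III: `N = 19, 23–27, 29–50`). Of
  Monach's theorem (Monach 1980 as reported in Platt–Trudgian 2016, §1: a zero with `σ > 1` for
  all `N > 30`; not a separately vendored named fact, see `TuranPartialSumsAssembly.lean`) the cases
  `N ≤ 1000` are proved (`Monach1980_exists_zero_of_le`).
* **The barrier `TuranPartialSums`** (`∀ N ≥ 29`, a zero with `σ > 1`) therefore reduces to zeros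
  for `N > 1000` (`TuranPartialSums_of_exists_zero_gt`), in particular to Monach's theorem
  (`TuranPartialSums_of_Monach1980`, Monach's statement being the explicit hypothesis; its
  remaining content is Monach's analytic argument for `N ≥ 549,798` — an explicit form of
  Montgomery 1983 — and his computation on `1000 < N < 549,798`, Platt–Trudgian 2016, §1;
  conversely the barrier gives Monach's statement back, `exists_zero_gt_thirty_of_TuranPartialSums`),
  and Theorem 1.1 itself reduces to the paper's own interval-arithmetic
  exclusion for `N ∈ {10,…,18,20,21,28}` plus zeros for `N > 1000`
  (`PlattTrudgian2016_thm11_of_exclusions`; the case `N ≤ 9` of the exclusions is the tree's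
  `zetaPartialSum_ne_zero_of_le_nine`; the form with Monach's theorem as the second input is the
  tree's `PlattTrudgian2016_thm11_of_two`, `TuranPartialSumsSpiraCertificates.lean`, whose
  certificates for `N = 19, 22–27, 29, 30` — Spira's criterion, exact arithmetic in `ℚ(i)` by
  `norm_num` — are independent of the ones used here).

## References

* [PlattTrudgian2016] D. J. Platt, T. S. Trudgian, *Zeroes of partial sums of the zeta-function*,
  LMS J. Comput. Math. 19 (2016), 37–41, §1 (Table 1 and the paragraph after it) and Thm. 1.1.
* [Spira1968] R. Spira, *Zeros of sections of the zeta function. II*, Math. Comp. 22 (1968),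
  163–173, §4 Table III.
* [vandeLuneTeRiele1982] J. van de Lune, H. J. J. te Riele, Math. Centre Tracts 155 (1982), 371–387
  (cited through [PlattTrudgian2016, §1]).
* [Monach1980] W. R. Monach, PhD thesis, University of Michigan, 1980 (cited through
  [PlattTrudgian2016, §1]).
-/

noncomputable section

namespace Literature.Barriers.RiemannHypothesis

/-- **Certified zeros, `29 ≤ N ≤ 1000`.** For every such `N` the section `ζ_N` has a zero with
`Re s > 1` (kernel certificates, `TuranPartialSumsRun1–5.lean`).
[cite: PlattTrudgian2016, Theorem 1.1] -/
theorem exists_zero_of_certificate (N : ℕ) (h₁ : 29 ≤ N) (h₂ : N ≤ 1000) :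
    ∃ s : ℂ, 1 < s.re ∧ zetaPartialSum N s = 0 := by
  rcases Nat.lt_or_ge N 400 with h | h
  · exact exists_zero_of_certificate_29_399 N h₁ h
  rcases Nat.lt_or_ge N 600 with h' | h'
  · exact exists_zero_of_certificate_400_599 N h h'
  rcases Nat.lt_or_ge N 750 with h'' | h''
  · exact exists_zero_of_certificate_600_749 N h' h''
  rcases Nat.lt_or_ge N 880 with h₃ | h₃
  · exact exists_zero_of_certificate_750_879 N h'' h₃
  · exact exists_zero_of_certificate_880_1000 N h₃ (by omega)

/-- The certified cases in one statement: `N = 19`, `22 ≤ N ≤ 27` or `29 ≤ N ≤ 1000`.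
[cite: PlattTrudgian2016, Theorem 1.1] -/
theorem exists_zero_of_certificate' (N : ℕ)
    (h : N = 19 ∨ (22 ≤ N ∧ N ≤ 27) ∨ (29 ≤ N ∧ N ≤ 1000)) :
    ∃ s : ℂ, 1 < s.re ∧ zetaPartialSum N s = 0 := by
  rcases h with rfl | ⟨h1, h2⟩ | ⟨h1, h2⟩
  · exact exists_zero_of_certificate_19 19 le_rfl (by norm_num)
  · exact exists_zero_of_certificate_22_27 N h1 (by omega)
  · exact exists_zero_of_certificate N h1 h2

/-! ## Discharges of the existence inputs of Theorem 1.1 -/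

/-- **van de Lune–te Riele's computed zeros — PROVED** (`vandeLuneTeRiele1982_exists_zero`,
`TuranPartialSumsAssembly.lean`; Platt–Trudgian 2016, §1: "van de Lune and te Riele actually
computed some zeroes of `ζ_N(s)` for `N = 19, 22–27, 29–35, 37–41, 47`"): for each of these `N` the
section `ζ_N` has a zero with `σ > 1` (kernel certificates). [cite: PlattTrudgian2016, §1]
[cite: vandeLuneTeRiele1982] -/
theorem vandeLuneTeRiele1982_exists_zero_holds : vandeLuneTeRiele1982_exists_zero := by
  intro N hN
  refine exists_zero_of_certificate' N ?_
  rcases hN with h | h | h | h | h <;> omega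

/-- **Spira's Table III — PROVED** (`Spira1968_exists_zero`, `TuranPartialSumsAssembly.lean`; Spira
1968, §4: "from Table III, for `N = 19`, `23` to `27` and `29` to `50`, `F_N` has roots with
`σ > 1`", hence, by his §2, so has `ζ_N`): kernel certificates.
[cite: Spira1968, §4 Table III and §2] -/
theorem Spira1968_exists_zero_holds : Spira1968_exists_zero := by
  intro N hN
  refine exists_zero_of_certificate' N ?_
  rcases hN with h | h | h <;> omega

/-- **Monach's theorem for `N ≤ 1000` — PROVED**: for `30 < N ≤ 1000` the section `ζ_N` has a
zero with `σ > 1` (kernel certificates; Monach 1980 as reported in Platt–Trudgian 2016, §1: "for all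
`N > 30` there are zeroes in `σ > 1`"). [cite: PlattTrudgian2016, §1] [cite: Monach1980] -/
theorem Monach1980_exists_zero_of_le (N : ℕ) (h₁ : 30 < N) (h₂ : N ≤ 1000) :
    ∃ s : ℂ, 1 < s.re ∧ zetaPartialSum N s = 0 :=
  exists_zero_of_certificate N (by omega) h₂

/-! ## What remains of the barrier `TuranPartialSums` and of Theorem 1.1 -/

/-- **The barrier from zeros beyond `N = 1000`.** `TuranPartialSums` (`∀ N ≥ 29`, a zero of `ζ_N`
with `σ > 1`) follows from the existence of such zeros for every `N > 1000`, the range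
`29 ≤ N ≤ 1000` being certified by the kernel. [cite: PlattTrudgian2016, Theorem 1.1] -/
theorem TuranPartialSums_of_exists_zero_gt
    (h : ∀ N : ℕ, 1000 < N → ∃ s : ℂ, 1 < s.re ∧ zetaPartialSum N s = 0) : TuranPartialSums := by
  intro N hN
  by_cases h' : N ≤ 1000
  · exact exists_zero_of_certificate N hN h'
  · exact h N (by omega)

/-- **The barrier from Monach's theorem** (Platt–Trudgian 2016, §1: "Monach made this explicit:
for all `N > 30` there are zeroes in `σ > 1`" — the hypothesis `hM`, stated as printed; the cases
`N = 29, 30` — van de Lune–te Riele — and indeed all `N ≤ 1000` are certified here, so only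
Monach's range `N > 1000` is used). [cite: PlattTrudgian2016, §1] [cite: Monach1980] -/
theorem TuranPartialSums_of_Monach1980
    (hM : ∀ N : ℕ, 30 < N → ∃ s : ℂ, 1 < s.re ∧ zetaPartialSum N s = 0) : TuranPartialSums :=
  TuranPartialSums_of_exists_zero_gt fun N hN ↦ hM N (by omega)

/-- Conversely the barrier `TuranPartialSums` (`∀ N ≥ 29`) contains Monach's statement (`∀ N > 30`):
granted the tree's certificates the two are equivalent, which is why Monach's theorem is carried as
an explicit hypothesis and not as a named fact of its own (`TuranPartialSumsAssembly.lean`).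
[cite: PlattTrudgian2016, §1] -/
theorem exists_zero_gt_thirty_of_TuranPartialSums (h : TuranPartialSums) (N : ℕ) (hN : 30 < N) :
    ∃ s : ℂ, 1 < s.re ∧ zetaPartialSum N s = 0 :=
  h N (by omega)

/-- **Theorem 1.1 from the paper's exclusion computation and zeros beyond `1000`.** With `ζ_N ≠ 0`
on `σ ≥ 1` for `N ≤ 9` proved in the tree (`zetaPartialSum_ne_zero_of_le_nine`), the computed zeros
for `N = 19, 22–27, 29–1000` certified here, and the Bohr–Spira infinitude proved
(`zetaPartialSum_setOf_zero_infinite`), Platt–Trudgian's Theorem 1.1 follows from their own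
interval-arithmetic exclusion for `N ∈ {10,…,18,20,21,28}`
(`PlattTrudgian2016_noZeros_sigma_ge_one`) and the existence of a zero with `σ > 1` for every
`N > 1000`. [cite: PlattTrudgian2016, §1 and Theorem 1.1] -/
theorem PlattTrudgian2016_thm11_of_exclusions (hPT : PlattTrudgian2016_noZeros_sigma_ge_one)
    (h : ∀ N : ℕ, 1000 < N → ∃ s : ℂ, 1 < s.re ∧ zetaPartialSum N s = 0) :
    PlattTrudgian2016_thm11 := by
  refine PlattTrudgian2016_thm11_of
    (PlattTrudgian2016_thm11_part_i
      (Spira1968_noZeros_le_nine_of_nine fun s hs ↦ zetaPartialSum_ne_zero_of_eq_nine hs) hPT)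
    fun N hN hnot ↦ ?_
  by_cases h' : N ≤ 1000
  · exact exists_zero_of_certificate' N (by omega)
  · exact h N (by omega)

/-- Hence also the barrier in the form derived in `TuranPartialSums.lean`
(`TuranPartialSums_of_PlattTrudgian`) needs only these two inputs.
[cite: PlattTrudgian2016, Theorem 1.1] -/
theorem TuranPartialSums_of_noZeros_of_exists_zero_gt (hPT : PlattTrudgian2016_noZeros_sigma_ge_one)
    (h : ∀ N : ℕ, 1000 < N → ∃ s : ℂ, 1 < s.re ∧ zetaPartialSum N s = 0) : TuranPartialSums :=
  TuranPartialSums_of_PlattTrudgian (PlattTrudgian2016_thm11_of_exclusions hPT h)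

end Literature.Barriers.RiemannHypothesis
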